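import Summits.CriticalPhenomena.PercolationContinuityZ3.Theses.PercGamblersRuin
import Summits.CriticalPhenomena.PercolationContinuityZ3.Theorems.PercGamblersRuinBGNOffTheFloorLevelMono
import Summits.CriticalPhenomena.PercolationContinuityZ3.Theorems.PercGamblersRuinBGNOffTheFloorStructure
import Summits.CriticalPhenomena.PercolationContinuityZ3.Theorems.PercGamblersRuinBGNOffTheFloorThreshold
import Summits.CriticalPhenomena.PercolationContinuityZ3.Theorems.PercGamblersRuinBGNOffTheFloorExitDichotomy
import Summits.CriticalPhenomena.PercolationContinuityZ3.Theorems.PercGamblersRuinBGNOffTheFloorPlaneGluing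
import Summits.CriticalPhenomena.PercolationContinuityZ3.Theorems.PercGamblersRuinBGNOffTheFloorLinearLRO
import Summits.CriticalPhenomena.PercolationContinuityZ3.Theorems.PercGamblersRuinBGNOffTheFloorHalfSpaceGluing
import Summits.CriticalPhenomena.PercolationContinuityZ3.Theorems.PercGamblersRuinBGNOffTheFloorSplit
import Summits.CriticalPhenomena.PercolationContinuityZ3.Theorems.PercGamblersRuinBGNOffTheFloorDominance
import Summits.CriticalPhenomena.PercolationContinuityZ3.Theorems.PercGamblersRuinBGNOffTheFloorBridges
import Summits.CriticalPhenomena.PercolationContinuityZ3.Theorems.PercGamblersRuinBGNOffTheFloorConjOneGluing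
import Summits.CriticalPhenomena.PercolationContinuityZ3.Theorems.PercGamblersRuinBGNOffTheFloorScaleFree

/-!
# Birth skeleton (BC3) for the crux `BGNOffTheFloor` (stmt-CriticalPhenomena-7773)

Route `route-CriticalPhenomena-PercGamblersRuin` (sub-problem `PercolationContinuityZ3`), crux decl
`Summit.CriticalPhenomena.PercolationContinuityZ3.Theses.PercGamblersRuin.BGNOffTheFloor` (rank 3):
at `p = p_c(ℤ³)`, for all integers `a < b` and every `ε > 0` there are arbitrarily large `n` with
`P(0 ↔ {x₀ = b n} inside {x₀ > −a n}) < ε` — "one cannot climb `b·n` from relative depth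
`λ = a/b < 1` above a floor" (Barsky–Grimmett–Newman is the floor AT the starting level).

THE LINE (the card's own ladder, `Ideas/climb-ratio-receding-floor-v2.md` milestone M2 → C1,
= the route header's "BGNOffTheFloor's own ladder: sub-linearly receding floor, then small λ",
then push `λ` up). Write `e_n(a,b) := P_{p_c}(E_n(a,b))` (`climbProb`) and
`OffFloorAt a b :≡ ∀ ε > 0, ∃ᶠ n, e_n(a,b) < ε` (`liminf_n e_n(a,b) = 0`), so that the crux is
LITERALLY `∀ a b, a < b → OffFloorAt a b` (`bgnOffTheFloor_iff`, `Iff.rfl`). Three registered stubs: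

* STUB 1 `stub_levelMono` (M, PROVABLE NOW): `b ≤ b' ⇒ e_n(a,b') ≤ e_n(a,b)` — a LATTICE path from
  the origin to the level `b'·n` inside the region visits the level `b·n` on the way (discrete
  intermediate value property, `zdGraph_adj_apply_le`), and its initial segment stays in the
  region. Only almost surely: the raw events are NOT nested (a configuration with a non-lattice
  "edge" `s(0, y)` open joins `0` to level `b'n` in one step), so the stub is the inequality of
  probabilities, via `DCT16.real_mono_of_forall_subset_edgeSet` (`P_p`-a.e. `ω ⊆ E(ℤ³)`).
* STUB 2 `stub_smallRatioBGN` (XL, OPEN — LOAD-BEARING): **BGN at one small positive relative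
  depth** — `∃ b₀, ∀ a ≥ 1, OffFloorAt a (a·b₀)`: at relative depth `λ₀ = 1/b₀` the receding floor
  still forbids the climb (milestone M2 of the card: the first genuinely scale-invariant case of
  BGN; BGN itself is depth `O(1)`, M1 is depth `o(n)`). Stated at every granularity `a ≥ 1` (pairs
  `(a, a·b₀)`, all of ratio `1/b₀`) and not only at `a = 1`, because the crux is a `liminf`
  (`∃ᶠ n`) statement and `E_n(a, a·b₀) = E_{a·n}(1, b₀)`: a subsequence of scales does not transfer
  across the rescaling `n ↦ a·n` (no monotonicity of `e_n` in `n` is known or claimed).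
* STUB 3 `stub_climbExtension` (L, OPEN — the ladder step): **unit extension of the climb at a
  fixed floor** — `∀ a ≥ 1, ∀ b > a, OffFloorAt a (b+1) → OffFloorAt a b`: if one cannot climb
  `(b+1)·n` from depth `a·n`, one cannot climb `b·n` either (along a subsequence). Its natural
  sufficient form is the one-scale ratio bound `e_n(a,b) ≤ K(a,b) · e_n(a,b+1)` for all large `n`
  (quasi-multiplicativity of the half-space one-arm probability in the LENGTH of the climb — the
  softest layer of arm-event technology; expected in the real world with `K → ((b+1)/b)^{x_b}`,
  bulk one-arm exponent `x_b ≈ 0.477`; BK gives only the opposite inequality), but only the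
  `liminf` implication is registered (it also holds wherever `OffFloorAt a b` holds outright, e.g.
  under the conjunct). In climb-function language (card: `λ* := sup {λ : L(λ) = 0}`) STUB 2 is
  `λ* > 0` and STUB 3 is "no threshold strictly inside `(0,1)`", discretised along
  `a/(b+1) ↦ a/b`; neither alone gives the crux (no comparison in `n` moves `λ`; retriage ×3).

RESHAPE (lead c2, 2026-08-17): STUB 1 is CLOSED (`Theorems/PercGamblersRuinBGNOffTheFloorLevelMono.lean`,
p146460); STUB 2 is split into `stub_unitRatioBGN` (the unit-granularity form `∃ b₀, liminf_m
e(m, b₀ m) = 0`, OPEN, load-bearing) and `stub_granularity` (unit ⇒ every granularity, PROVED in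
`Theorems/PercGamblersRuinBGNOffTheFloorStructure.lean` by floor-depth + ceiling monotonicity — the
belief above that the `liminf` does not transfer across `n ↦ a n` was too pessimistic: it transfers at
the price `b₀ ↦ 2 b₀`); STUB 3 is OPEN (wave-1 worker: `stub-blocked: none`, weakest missing estimate a
one-scale gluing lower bound `c e_n(a,b)² ≤ e_n(a,b+1)`, no 3D tool). The same Structure file records
that the crux is conjunct-implied (`bgnOffTheFloor_of_percolationContinuityZ3`) and that its diagonal
`a = b` analogue is conjunct-EQUIVALENT (`theta_le_two_mul_climb_diag`: `θ(p_c) ≤ 2 e(N, N)` by BGN +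
reflection), i.e. the crux is the first member of its family not provably equivalent to `θ(p_c) = 0`.

RESHAPE (lead c3, 2026-08-17): a fourth registered stub `stub_ratioMono` (RATIO MONOTONICITY:
`a' b < a b' → OffFloorAt a b → OffFloorAt a' b'`, PROVED in
`Theorems/PercGamblersRuinBGNOffTheFloorThreshold.lean`) replaces STUB 1 + STUB 2b in the composition and
exhibits the threshold structure of the crux family: with `λ* := sup {a/b : OffFloorAt a b} ∈ [0,1]`,
`UnitRatioBGN ⟺ ∃ one pair (a,b), 1 ≤ a < b, OffFloorAt a b ⟺ λ* > 0`, `ClimbExtension ⟺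
(UnitRatioBGN → crux) ⟺ λ* ∈ {0,1}`, crux `⟺ ∀ k ≥ 1, OffFloorAt k (k+1) ⟺ λ* = 1` (all kernel-checked
in the Threshold file). So the two open stubs are the existential shadow `U` of the crux and the
implication `U → crux`: the line isolates no further θ-blind content.

RESHAPE (lead c4, 2026-08-17): a seventh registered stub `stub_halfSpaceGluing` (STRUCTURAL; CLOSED in
wave 1, p157302, `Theorems/PercGamblersRuinBGNOffTheFloorHalfSpaceGluing.lean`): the one-sided half `e_n(a,b) · f(1,n) ≤ e_n(a,b+1)` of STUB 5 that the
Markov property at the first hit of the plane `{z₀ = b n}` gives for free (gluing factor = the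
HALF-SPACE climb `f(1,n)`, BGN-small, instead of the full-depth `f((a+b) n, n)` of STUB 5). The
composition is unchanged (`stub_unitRatioBGN → stub_planeGluing → BGNOffTheFloor`); STUB 7 records in
the tree exactly where the line's glue exceeds what is provable.

RESHAPE (lead c5, 2026-08-17): a ninth registered stub `stub_dominatesRenormalise` (STRUCTURAL; CLOSED,
p160985, `Theorems/PercGamblersRuinBGNOffTheFloorDominance.lean`): the load-bearing open stub already implies
the crux `RenormaliseFromLinearLRO` (stmt-CriticalPhenomena-0857) of route `PercFiniteBoxLRO` —
`UnitRatioBGN ⟹ ¬LRO_lin(p_c) ⟺ R` — so `θ(p_c) = 0 ⟹ crux ⟹ UnitRatioBGN ⟹ R` and, with p153598,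
`UnitRatioBGN` can replace `R` in that route's pair `X_D ∧ R`. The composition is unchanged; the line stays
dead (`Lines/birth-dead.md`, `Lines/registered-dead.md`).

RESHAPE (lead c6, 2026-08-17): two further STRUCTURAL stubs (not antecedents of `BGNOffTheFloor_of`) that
record what the tree already decides about this line. STUB 10 `stub_nearOneGluingDominates`: the crux is
DOMINATED by crux `NearOneGluing` (stmt-CriticalPhenomena-4574, Kozma–Nitzan Conjecture 3) of route
`PercNearOneGluing`, whose bridge `KNSlabBridge` (KN Theorem 6, `d = 3`) and assembly are PROVED — so
`NearOneGluing ⟹ θ(p_c) = 0 ⟹ BGNOffTheFloor`; the same holds for `AdditiveGluing` (4576),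
`NoHeavyLowerTail` (4575) and for KN Conjecture 1 itself, of which the open glue STUB 5 is the
separating-plane instance: Conjecture 1 as a bridge is idle for this crux (it closes the sub-problem in the
tree). STUB 11 `stub_splitGlueEventually`: the composition survives weakening STUB 5 to plane gluing UP TO A
CONSTANT AND FOR LARGE `n` (`PlaneGluingEventually`: `∀ 1 ≤ a < b, ∃ C N, ∀ n ≥ N, e_n(a,b) f((a+b)n,n) ≤
C e_n(a,b+1)`), the weakest gluing of this shape that still gives `UnitRatioBGN → crux`. Both landed in
`Theorems/PercGamblersRuinBGNOffTheFloorBridges.lean` (p164281). STUB 12 `stub_planeGluingOfConj1` (STRUCTURAL,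
CLOSED p165334, `Theorems/PercGamblersRuinBGNOffTheFloorConjOneGluing.lean` over the Literature transfer
`KozmaNitzanConjecture1Transfer.lean`, p164753): KN Conjecture 1 ⟹ STUB 5 verbatim — the glue stub is a certified
instance of Conjecture 1 (so `BGNOffTheFloor_of hunit (stub_planeGluingOfConj1 hC1)` closes the crux from STUB 2 and
Conjecture 1; idle as a route, since Conjecture 1 alone gives the crux in the tree, but it locates the line's glue exactly).

RESHAPE (lead c7, 2026-08-17): a thirteenth registered stub `stub_splitGlueScaleFree` (STRUCTURAL GLUE; CLOSED,
p167713, `Theorems/PercGamblersRuinBGNOffTheFloorScaleFree.lean`): the WEAKEST gluing of the line's shape —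
`stub_unitRatioBGN → JumpScaleFreeGluing → BGNOffTheFloor` with `JumpScaleFreeGluing :≡ θ(p_c) > 0 → ∀ 1 ≤ a < b,
∃ c > 0, ∃ N, ∀ n ≥ N, c · e_n(a,b) ≤ e_n(a,b+1)` (scale-free length quasi-multiplicativity, asked only in a
jump world; implied by STUB 11's `PlaneGluingEventually` with `c = θ(p_c)/(2 max(C,1))`, and vacuous when
`θ(p_c) = 0`). Lead c7's Monte Carlo (item evidence `MC-planeGluing-c7.md`, compute job j026700) shows why this
is the honest shape: at `p_c(ℤ³)` the ratio `e_n(a,b+1)/e_n(a,b)` is scale-free (0.747 ± 0.004 for (1,2),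
n = 2…12) while STUB 5's Kozma–Nitzan factor `f((a+b)n,n)` decays like `n^{-0.42}`, so STUB 5 holds numerically
with a margin growing like `1.25 n^{0.44}` (minimum 1.246 at (a,b,n) = (1,2,1); 22 configurations, n ≤ 16).
The composition and the two open stubs are unchanged; the line stays blocked (`LEAD-c7-STATUS.md`).

Composition (kernel-checked, no `sorry`): `BGNOffTheFloor_of : stub_unitRatioBGN → stub_climbExtension →
stub_ratioMono → BGNOffTheFloor` (hypotheses typed by the name-keyed aliases `__Registered.stub_*`;
the c2 composition used the closed stubs `stub_levelMono`, `stub_granularity` instead of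
`stub_ratioMono`), and `bgnOffTheFloor_iff_open_stubs : RatioMono → (BGNOffTheFloor ↔ UnitRatioBGN ∧
ClimbExtension)` (the split is exact).
The case `a = 0` is vacuous in the route's origin-centred form
(`0 ∉ {z | 0 < z₀}`, `climbEvent_zero_left`, so `e_n(0,b) = 0`; noted by grounder g13-41 and
refuter 9b2fb0d4); for `a ≥ 1`: one pair `(a₁, b₁)` off the floor from STUB 2 (`exists_pair_of_unit`),
ceilings `b ≥ a·b₁ + 1` by STUB 4 (smaller ratio), ceilings `a < b ≤ a·b₁` by downward induction on
`b` with STUB 3.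

DISPROOF USED: none exists for this crux (`ledger crux ls stmt-CriticalPhenomena-7773`: no
workfiles, no `Disproof.lean`, no landed Negative lemma, 2026-08-17). Negatives index of the
summit: not touched (no half-space / climb statement). Kill criterion (iii) of the route applies
to STUBS 2–3 as to the crux: both are consequences of the crux (`smallRatioBGN_of`,
`climbExtension_of` below), hence of the conjunct, and are refutable only by refuting the
conjunct `θ(p_c) = 0` itself; STUB 1 is a theorem.
-/

noncomputable section

namespace Summit.CriticalPhenomena.PercolationContinuityZ3.Cruxes.BGNOffTheFloor.Birth

open MeasureTheory Filter Literature.Probability.Percolation Literature.Probability.LatticeModels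
open Summit.CriticalPhenomena.PercolationContinuityZ3.Theses.PercGamblersRuin (BGNOffTheFloor)

/-! ## Objects of the line -/

/-- The critical bond percolation measure on `ℤ³`. -/
abbrev μc : Measure (BondConfig (Site 3)) := bondPercolation (zdGraph 3) (criticalProbI 3)

/-- The CLIMB EVENT `E_n(a,b)`: the origin is joined to the level `{x₀ = b·n}` by an open path
inside the region `{x₀ > −a·n}` above the floor (verbatim the event of the crux). -/
def climbEvent (a b n : ℕ) : Set (BondConfig (Site 3)) :=
  {ω | ∃ y : Site 3, y 0 = ((b * n : ℕ) : ℤ) ∧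
    ω ∈ openConnIn {z : Site 3 | -((a * n : ℕ) : ℤ) < z 0} 0 y}

/-- `e_n(a,b) := P_{p_c}(E_n(a,b))`. -/
def climbProb (a b n : ℕ) : ℝ := μc.real (climbEvent a b n)

/-- `OffFloorAt a b`: `liminf_n e_n(a,b) = 0` — BGN off the floor at the pair `(a,b)`
(relative depth `a/b`). -/
def OffFloorAt (a b : ℕ) : Prop := ∀ ε : ℝ, 0 < ε → ∃ᶠ n : ℕ in atTop, climbProb a b n < ε

/-- The crux is literally `∀ a < b, OffFloorAt a b`. -/
theorem bgnOffTheFloor_iff : BGNOffTheFloor ↔ ∀ a b : ℕ, a < b → OffFloorAt a b := Iff.rfl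

/-! ## The three stub statements
The registered stubs below are stated SELF-CONTAINED, in the Literature vocabulary only (no line-local
definition occurs in a registered signature), so that each stub file under `Theorems/` proves its stub
verbatim without importing anything of this line; the named statements `LevelMono`, `SmallRatioBGN`,
`ClimbExtension` are DEFINITIONALLY those signatures (`climbProb a b n` unfolds to the crux's
probability), see `levelMono_iff`, `smallRatioBGN_iff`, `climbExtension_iff` (`Iff.rfl`). -/

/-- STUB 1 statement: a higher ceiling is harder to reach (same floor, same scale). -/
def LevelMono : Prop := ∀ a b b' n : ℕ, b ≤ b' → climbProb a b' n ≤ climbProb a b n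

/-- DERIVED STUB 2 statement (no longer registered as such since the c2 reshape): BGN at ONE small
positive relative depth `1/b₀`, at every granularity `a`; it is `Granularity` applied to `UnitRatioBGN`. -/
def SmallRatioBGN : Prop := ∃ b₀ : ℕ, ∀ a : ℕ, 1 ≤ a → OffFloorAt a (a * b₀)

/-- The climb probability at unit granularity with an arbitrary integer scale `m`: floor at depth `m`,
ceiling at height `b₀ m` (this is `climbProb 1 b₀ m` up to the syntactic `1 * m`). -/
def unitClimbProb (b₀ m : ℕ) : ℝ :=
  μc.real {ω | ∃ y : Site 3, y 0 = ((b₀ * m : ℕ) : ℤ) ∧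
    ω ∈ openConnIn {z : Site 3 | -((m : ℕ) : ℤ) < z 0} 0 y}

/-- STUB 2 statement (reshaped, lead c2): BGN at ONE small positive relative depth `1/b₀`, at UNIT
granularity — `∃ b₀, liminf_m P_{p_c}(0 ↔ {x₀ = b₀ m} inside {x₀ > −m}) = 0`. -/
def UnitRatioBGN : Prop := ∃ b₀ : ℕ, ∀ ε : ℝ, 0 < ε → ∃ᶠ m : ℕ in atTop, unitClimbProb b₀ m < ε

/-- STUB 2b statement (reshaped, lead c2; PROVED in `Theorems/PercGamblersRuinBGNOffTheFloorStructure.lean`):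
granularity transfer `UnitRatioBGN → SmallRatioBGN` (at the price `b₀ ↦ 2 b₀`, by floor-depth and
ceiling monotonicity: `E_n(a, 2 a b₀) ⊆ E(m, b₀ m)` for `a n ≤ m < a (n+1)`, `n ≥ 1`). -/
def Granularity : Prop := UnitRatioBGN → SmallRatioBGN

/-- STUB 3 statement: unit extension of the climb at a fixed floor (ladder step `a/(b+1) ↦ a/b`). -/
def ClimbExtension : Prop := ∀ a b : ℕ, 1 ≤ a → a < b → OffFloorAt a (b + 1) → OffFloorAt a b

/-- STUB 4 statement (lead c3 reshape): RATIO MONOTONICITY — `OffFloorAt` descends to every strictly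
smaller ratio `a'/b' < a/b` (any granularity). PROVED in
`Theorems/PercGamblersRuinBGNOffTheFloorThreshold.lean` (`stub_ratioMono`). -/
def RatioMono : Prop := ∀ a b a' b' : ℕ, a' * b < a * b' → OffFloorAt a b → OffFloorAt a' b'

/-- The gluing factor of plane gluing: `f((a+b) n, n) = P_{p_c}(0 ⟷ {z₀ = n} in {z₀ > -(a+b) n})` — by
translation invariance the common value of `P(y ⟷ {z₀ = (b+1) n} in {z₀ > -a n})` over the sites `y`
of the plane `{z₀ = b n}`. -/
def glueProb (a b n : ℕ) : ℝ :=
  μc.real {ω | ∃ y : Site 3, y 0 = ((n : ℕ) : ℤ) ∧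
    ω ∈ openConnIn {z : Site 3 | -(((a + b) * n : ℕ) : ℤ) < z 0} 0 y}

/-- STUB 5 statement (lead c3 reshape, OPEN — replaces STUB 3 as the registered open piece): PLANE
GLUING — `e_n(a,b) · f((a+b) n, n) ≤ e_n(a,b+1)` for `1 ≤ a < b`, `n ≥ 1`: the instance
`G = {z₀ > -a n}`, `A = {z₀ = b n}`, `B = {z₀ = (b+1) n}` of the post-FKG correlation inequality
`P(0 ⟷ B) ≥ P(0 ⟷ A) · min_{y ∈ A} P(y ⟷ B)` of Kozma–Nitzan (arXiv:2401.12397, Conjecture 1; proved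
there for `|A| = 2` and for `0` adjacent to `A`; the full conjecture gives `θ(p_c) = 0`, §4), in
infinite volume. -/
def PlaneGluing : Prop := ∀ a b n : ℕ, 1 ≤ a → a < b → 1 ≤ n →
  climbProb a b n * glueProb a b n ≤ climbProb a (b + 1) n

/-- STUB 6 statement (lead c3 reshape, glue — PROVED in
`Theorems/PercGamblersRuinBGNOffTheFloorPlaneGluing.lean`): plane gluing implies the ladder step,
θ-blindly (cases on `θ(p_c) = 0`; in a jump world the gluing factor is `≥ θ(p_c)/2` at every scale by
the diagonal bound). -/
def ClimbExtensionOfPlaneGluing : Prop := PlaneGluing → ClimbExtension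

/-- `climbProb` IS the crux's probability (definitional readback). -/
theorem climbProb_eq (a b n : ℕ) : climbProb a b n =
    (bondPercolation (zdGraph 3) (criticalProbI 3)).real
      {ω | ∃ y : Site 3, y 0 = ((b * n : ℕ) : ℤ) ∧
        ω ∈ openConnIn {z : Site 3 | -((a * n : ℕ) : ℤ) < z 0} 0 y} := rfl

/-! ## Registered stubs -/

/-- **STUB 1 `levelMono`** (M, PROVABLE NOW): `b ≤ b' → e_n(a,b') ≤ e_n(a,b)`.
Proof sketch: by `DCT16.real_mono_of_forall_subset_edgeSet (zdGraph 3) (criticalProbI 3)` it is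
enough to treat `ω ⊆ E(ℤ³)`; then the open induced graph on the region is a subgraph of `zdGraph 3`,
a walk from `0` (level `0 ≤ b n`) to `y` (level `b' n ≥ b n`) changes `x₀` by at most `1` per step
(`zdGraph_adj_apply_le … 0`, cf. `exists_mem_support_apply_eq` for `d = 2` in `RSWLemma`), so its
support meets the level `b n` at some `z`, and the prefix `takeUntil z` is an open walk inside the
region: `ω ∈ E_n(a,b)`. Degenerate cases (`a = 0` or `n = 0`: `0 ∉` region, both events empty;
`b = 0`: witness `y = 0`) need no separate treatment. -/
theorem stub_levelMono : ∀ a b b' n : ℕ, b ≤ b' →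
    (bondPercolation (zdGraph 3) (criticalProbI 3)).real
        {ω | ∃ y : Site 3, y 0 = ((b' * n : ℕ) : ℤ) ∧
          ω ∈ openConnIn {z : Site 3 | -((a * n : ℕ) : ℤ) < z 0} 0 y} ≤
      (bondPercolation (zdGraph 3) (criticalProbI 3)).real
        {ω | ∃ y : Site 3, y 0 = ((b * n : ℕ) : ℤ) ∧
          ω ∈ openConnIn {z : Site 3 | -((a * n : ℕ) : ℤ) < z 0} 0 y} :=
  -- STUB 1 CLOSED (lead c2, wave 1, p146460): `Theorems/PercGamblersRuinBGNOffTheFloorLevelMono.lean`.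
  Summit.CriticalPhenomena.PercolationContinuityZ3.Theorems.stub_levelMono

/-- **STUB 2 `smallRatioBGN`** (XL, OPEN — LOAD-BEARING): there is `b₀` such that for every
`a ≥ 1`, `liminf_n P_{p_c}(0 ↔ {x₀ = a b₀ n} inside {x₀ > −a n}) = 0`. A quantitative
Barsky–Grimmett–Newman in which the floor recedes at relative depth `1/b₀` and still steers
(card climb-ratio-receding-floor-v2, milestone M2; Grimmett 1999 §7.3 "no extra money is
required" is the depth-`O(1)` case, in tree as `BarskyGrimmettNewman1991_Z3_holds` with the whole
§7.3 block machinery `BGN.lemma_7_36C_at`, `BGN.theta_pos_of_goodC`, `BGN.continuous_prob_goodC`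
available for a receding-floor rerun). Why it might fail: false in a non-sprawling `θ(p_c) > 0`
world, so only a `θ`-blind argument proves it; no receding-floor BGN is in print (Kozma–Nitzan
2024 §1(4) and the `d > 6` half-space estimates arXiv:1810.03750, arXiv:2512.13624 are nearest).
RESHAPED by lead c2 (2026-08-17): the registered form is now the UNIT-GRANULARITY statement
`stub_unitRatioBGN` below (one floor-depth sequence `m`, ceiling `b₀ m`); the every-granularity form
follows from it by the registered and PROVED transfer `stub_granularity`. -/
theorem stub_unitRatioBGN : ∃ b₀ : ℕ, ∀ ε : ℝ, 0 < ε → ∃ᶠ m : ℕ in atTop,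
    (bondPercolation (zdGraph 3) (criticalProbI 3)).real
        {ω | ∃ y : Site 3, y 0 = ((b₀ * m : ℕ) : ℤ) ∧
          ω ∈ openConnIn {z : Site 3 | -((m : ℕ) : ℤ) < z 0} 0 y} < ε := by
  sorry

/-- **STUB 2b `granularity`** (S, PROVED — lead c2, `Theorems/PercGamblersRuinBGNOffTheFloorStructure.lean`,
`OffFloor.stub_granularity`): the unit-granularity statement transfers to every granularity `a ≥ 1`
(conclusion = the former registered signature of `stub_smallRatioBGN`, with `b₀ ↦ 2 b₀` inside the proof):
for the scales `m` of the hypothesis put `n = ⌊m/a⌋`, then `a n ≤ m < a(n+1) ≤ 2 a n` and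
`E_n(a, 2 a b₀) ⊆ E(m, b₀ m)` a.s. by floor-depth and ceiling monotonicity. -/
theorem stub_granularity :
    (∃ b₀ : ℕ, ∀ ε : ℝ, 0 < ε → ∃ᶠ m : ℕ in atTop,
      (bondPercolation (zdGraph 3) (criticalProbI 3)).real
        {ω | ∃ y : Site 3, y 0 = ((b₀ * m : ℕ) : ℤ) ∧
          ω ∈ openConnIn {z : Site 3 | -((m : ℕ) : ℤ) < z 0} 0 y} < ε) →
    ∃ b₀ : ℕ, ∀ a : ℕ, 1 ≤ a → ∀ ε : ℝ, 0 < ε → ∃ᶠ n : ℕ in atTop,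
      (bondPercolation (zdGraph 3) (criticalProbI 3)).real
        {ω | ∃ y : Site 3, y 0 = ((a * b₀ * n : ℕ) : ℤ) ∧
          ω ∈ openConnIn {z : Site 3 | -((a * n : ℕ) : ℤ) < z 0} 0 y} < ε :=
  -- STUB 2b CLOSED (lead c2, p148464): `Theorems/PercGamblersRuinBGNOffTheFloorStructure.lean`.
  Summit.CriticalPhenomena.PercolationContinuityZ3.Theorems.stub_granularity

/-- **STUB 4 `ratioMono`** (S, lead c3 reshape — CLOSED, p152651,
`Theorems/PercGamblersRuinBGNOffTheFloorThreshold.lean`, `Theorems.stub_ratioMono`): ratio monotonicity of `OffFloorAt` — if `a' b < a b'` (i.e. `a'/b' < a/b`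
STRICTLY) and `liminf_n e_n(a,b) = 0` then `liminf_n e_n(a',b') = 0`. For the scales `n` of the
hypothesis take `n' = ⌊a n / a'⌋` (`n ≥ a' b'`): then `a' n' ≤ a n`, `b n ≤ b' n'`, so
`E(a' n', b' n') ⊆ E(a n, b n)` a.s. by floor-depth and ceiling monotonicity
(`OffFloor.climb_real_mono`). It replaces STUB 1 + STUB 2b in the composition (the base ceilings
`b ≥ a b₁ + 1` above the floor `a` come straight from ONE pair `(a₁, b₁)` off the floor) and shows
that the instances of the crux are governed by the single threshold `λ* = sup {a/b : OffFloorAt a b}`: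
`UnitRatioBGN ⟺ λ* > 0`, `ClimbExtension ⟺ λ* ∈ {0,1}`, crux `⟺ λ* = 1`
(`OffFloor.unitRatioBGN_iff_exists_pair`, `OffFloor.climbExtension_iff_unit_imp`,
`OffFloor.bgnOffTheFloor_iff_cofinal` in the Threshold file). -/
theorem stub_ratioMono : ∀ a b a' b' : ℕ, a' * b < a * b' →
    (∀ ε : ℝ, 0 < ε → ∃ᶠ n : ℕ in atTop,
      (bondPercolation (zdGraph 3) (criticalProbI 3)).real
        {ω | ∃ y : Site 3, y 0 = ((b * n : ℕ) : ℤ) ∧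
          ω ∈ openConnIn {z : Site 3 | -((a * n : ℕ) : ℤ) < z 0} 0 y} < ε) →
    ∀ ε : ℝ, 0 < ε → ∃ᶠ n : ℕ in atTop,
      (bondPercolation (zdGraph 3) (criticalProbI 3)).real
        {ω | ∃ y : Site 3, y 0 = ((b' * n : ℕ) : ℤ) ∧
          ω ∈ openConnIn {z : Site 3 | -((a' * n : ℕ) : ℤ) < z 0} 0 y} < ε :=
  -- STUB 4 CLOSED (lead c3, p152651): `Theorems/PercGamblersRuinBGNOffTheFloorThreshold.lean`.
  Summit.CriticalPhenomena.PercolationContinuityZ3.Theorems.stub_ratioMono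

/-- **STUB 5 `planeGluing`** (OPEN, lead c3 reshape — the registered open piece replacing STUB 3):
`e_n(a,b) · f((a+b) n, n) ≤ e_n(a,b+1)` for `1 ≤ a < b`, `n ≥ 1`, where
`f((a+b) n, n) = P_{p_c}(0 ⟷ {z₀ = n} in {z₀ > -(a+b) n})` is, by translation invariance, the common
value of `P_{p_c}(y ⟷ {z₀ = (b+1) n} in {z₀ > -a n})` over the sites `y` of the plane `{z₀ = b n}`.
This is ONE instance family (region `{z₀ > -a n}`, `A` = the plane `{z₀ = b n}`, target = the plane
`{z₀ = (b+1) n}` contracted to a vertex by sure edges, infinite-volume limit along centred discs of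
`A`) of the post-FKG inequality `P(0 ⟷ b) ≥ P(0 ⟷ A) · min_{a ∈ A} P(a ⟷ b)` CONJECTURED by
Kozma–Nitzan for every finite graph with arbitrary edge weights (arXiv:2401.12397, Conjecture 1;
proved there for `|A| = 2`, for some `|A| = 3`, and for `0` adjacent to `A`; numerically supported;
the full conjecture implies `θ(p_c) = 0` for all `d ≥ 2`, loc. cit. §4 — so this stub is
conjecture-implied, NOT conjunct-implied: it is a correlation inequality, meaningful and open in
every world). Why it might fail: Conjecture 1 is open even for separating sets `A`; BK gives only the
reverse-type bound `e_n(a,b+1) ≤ E[#{y ∈ A reached}] · f`. -/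
theorem stub_planeGluing : ∀ a b n : ℕ, 1 ≤ a → a < b → 1 ≤ n →
    (bondPercolation (zdGraph 3) (criticalProbI 3)).real
        {ω | ∃ y : Site 3, y 0 = ((b * n : ℕ) : ℤ) ∧
          ω ∈ openConnIn {z : Site 3 | -((a * n : ℕ) : ℤ) < z 0} 0 y} *
      (bondPercolation (zdGraph 3) (criticalProbI 3)).real
        {ω | ∃ y : Site 3, y 0 = ((n : ℕ) : ℤ) ∧
          ω ∈ openConnIn {z : Site 3 | -(((a + b) * n : ℕ) : ℤ) < z 0} 0 y} ≤
    (bondPercolation (zdGraph 3) (criticalProbI 3)).real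
        {ω | ∃ y : Site 3, y 0 = (((b + 1) * n : ℕ) : ℤ) ∧
          ω ∈ openConnIn {z : Site 3 | -((a * n : ℕ) : ℤ) < z 0} 0 y} := by
  sorry

/-- **STUB 7 `halfSpaceGluing`** (STRUCTURAL, lead c4 reshape — PROVABLE NOW, M/L; not an antecedent
of `BGNOffTheFloor_of`): the ONE-SIDED half of STUB 5 — `e_n(a,b) · f(1, n) ≤ e_n(a,b+1)` for
`1 ≤ a < b`, `n ≥ 1`, where `f(1, n) = P_{p_c}(0 ⟷ {z₀ = n} in {z₀ ≥ 0})` is the HALF-SPACE climb of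
`n` levels from a boundary point (the gluing factor of STUB 5 has the full depth `(a+b) n` below the
plane `A = {z₀ = b n}`; this one has depth `0`). Proof (Markov property at the first hit of the plane,
no conditional expectations needed): decompose `E_n(a,b) = ⋃̇_x F_x` (a.s., `ω ⊆ E(ℤ³)`) along the
MINIMAL (for a fixed enumeration of `Site 3`) site `x` of the level `b n - 1` that is joined to `0` inside
the slab `{-a n < z₀ ≤ b n - 1}` and has its vertical edge `s(x, x + e₀)` open — `F_x` is measurable
with respect to the edges with both endpoints in `{z₀ ≤ b n}` minus the edges inside the plane
`{z₀ = b n}`; the climb `U_x = {x + e₀ ⟷ {z₀ = (b+1) n} in {z₀ ≥ b n}}` is measurable with respect to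
the edges with both endpoints in `{z₀ ≥ b n}` (a disjoint edge class) and has probability `f(1, n)` by
the translation `x + e₀ ↦ 0`; so `P(E_n(a,b+1)) ≥ Σ_x P(F_x ∩ U_x) = Σ_x P(F_x) f(1,n) = e_n(a,b) f(1,n)`
(`F_x ∩ U_x ⊆ E_n(a,b+1)`: concatenate `0 → x → x + e₀ → {z₀ = (b+1) n}`, all inside `{z₀ > -a n}`).
This is the instance "`A` = plane, edges split at `A`" of the trivially true ONE-SIDED Kozma–Nitzan
inequality `P(0 ⟷ B) ≥ P(0 ⟷ A in G₀) · min_a P(a ⟷ B in G_B)` for edge-disjoint `G₀ ∋ 0`, `G_B ∋ B`;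
it records exactly what the Markov property gives for free and where STUB 5 exceeds it (the factor
`f(1,n) → 0` by BGN, versus `f((a+b) n, n) ≥ θ(p_c)/2` in a jump world). -/
theorem stub_halfSpaceGluing : ∀ a b n : ℕ, 1 ≤ a → a < b → 1 ≤ n →
    (bondPercolation (zdGraph 3) (criticalProbI 3)).real
        {ω | ∃ y : Site 3, y 0 = ((b * n : ℕ) : ℤ) ∧
          ω ∈ openConnIn {z : Site 3 | -((a * n : ℕ) : ℤ) < z 0} 0 y} *
      (bondPercolation (zdGraph 3) (criticalProbI 3)).real
        {ω | ∃ y : Site 3, y 0 = ((n : ℕ) : ℤ) ∧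
          ω ∈ openConnIn {z : Site 3 | 0 ≤ z 0} 0 y} ≤
    (bondPercolation (zdGraph 3) (criticalProbI 3)).real
        {ω | ∃ y : Site 3, y 0 = (((b + 1) * n : ℕ) : ℤ) ∧
          ω ∈ openConnIn {z : Site 3 | -((a * n : ℕ) : ℤ) < z 0} 0 y} :=
  -- STUB 7 CLOSED (lead c4, wave 1, p157302): `Theorems/PercGamblersRuinBGNOffTheFloorHalfSpaceGluing.lean`.
  Summit.CriticalPhenomena.PercolationContinuityZ3.Theorems.stub_halfSpaceGluing

/-- **STUB 8 `splitGlue`** (STRUCTURAL GLUE, lead c4 — CLOSED p158687,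
`Theorems/PercGamblersRuinBGNOffTheFloorSplit.lean`): the line's composition ITSELF —
`stub_unitRatioBGN → stub_planeGluing → BGNOffTheFloor`, both antecedents being the registered stub
signatures verbatim — registered so that it can be landed under `Theorems/` as an importable split glue
(`Theorems.bgnOffTheFloor_of_unitRatioBGN_of_planeGluing`, for a planner's `route edit --split … --glue-by`):
plane gluing gives `ClimbExtension` (STUB 6) and `ClimbExtension ↔ (UnitRatioBGN → crux)`
(`OffFloor.climbExtension_iff_unit_imp`, Threshold file). -/
theorem stub_splitGlue :
    (∃ b₀ : ℕ, ∀ ε : ℝ, 0 < ε → ∃ᶠ m : ℕ in atTop,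
      (bondPercolation (zdGraph 3) (criticalProbI 3)).real
        {ω | ∃ y : Site 3, y 0 = ((b₀ * m : ℕ) : ℤ) ∧
          ω ∈ openConnIn {z : Site 3 | -((m : ℕ) : ℤ) < z 0} 0 y} < ε) →
    (∀ a b n : ℕ, 1 ≤ a → a < b → 1 ≤ n →
      (bondPercolation (zdGraph 3) (criticalProbI 3)).real
          {ω | ∃ y : Site 3, y 0 = ((b * n : ℕ) : ℤ) ∧
            ω ∈ openConnIn {z : Site 3 | -((a * n : ℕ) : ℤ) < z 0} 0 y} *
        (bondPercolation (zdGraph 3) (criticalProbI 3)).real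
          {ω | ∃ y : Site 3, y 0 = ((n : ℕ) : ℤ) ∧
            ω ∈ openConnIn {z : Site 3 | -(((a + b) * n : ℕ) : ℤ) < z 0} 0 y} ≤
      (bondPercolation (zdGraph 3) (criticalProbI 3)).real
          {ω | ∃ y : Site 3, y 0 = (((b + 1) * n : ℕ) : ℤ) ∧
            ω ∈ openConnIn {z : Site 3 | -((a * n : ℕ) : ℤ) < z 0} 0 y}) →
    Summit.CriticalPhenomena.PercolationContinuityZ3.Theses.PercGamblersRuin.BGNOffTheFloor :=
  -- STUB 8 CLOSED (lead c4, p158687): `Theorems/PercGamblersRuinBGNOffTheFloorSplit.lean`.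
  Summit.CriticalPhenomena.PercolationContinuityZ3.Theorems.stub_splitGlue

/-- **STUB 9 `dominatesRenormalise`** (STRUCTURAL, lead c5 — not an antecedent of
`BGNOffTheFloor_of`; records a cross-route EDGE): the load-bearing open stub ALREADY implies the crux
`RenormaliseFromLinearLRO` (`R`, stmt-CriticalPhenomena-0857) of route `PercFiniteBoxLRO` —
`UnitRatioBGN → R`. Since `R ⟺ ¬LRO_lin(p_c)` (anatomy of crux 0857,
`Theorems.RenormaliseFromLinearLRO.stub_cruxIffNotLinearLROAtPc`) it suffices that `UnitRatioBGN`
excludes linear-scale box LRO at `p_c`, which is FKG chaining above the receding floor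
(`OffFloor.climb_ge_of_boxLRO`, p153598: box LRO at `p_c` gives `P_{p_c}(E(m, b₀ m)) ≥ ρ^(max K 1 · b₀)`
for all large `m`). So `θ(p_c) = 0 ⟹ crux ⟹ UnitRatioBGN ⟹ R`, and with p153598
(`UnitRatioBGN ∧ X_D ⟹ θ(p_c) = 0`) the stub can replace `R` in route `PercFiniteBoxLRO`'s pair
`X_D ∧ R`: any proof of this crux proves stmt-0857. Landed in
`Theorems/PercGamblersRuinBGNOffTheFloorDominance.lean` (`renormaliseFromLinearLRO_of_unitRatioBGN`,
`renormaliseFromLinearLRO_of_bgnOffTheFloor`). -/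
theorem stub_dominatesRenormalise :
    (∃ b₀ : ℕ, ∀ ε : ℝ, 0 < ε → ∃ᶠ m : ℕ in atTop,
      (bondPercolation (zdGraph 3) (criticalProbI 3)).real
        {ω | ∃ y : Site 3, y 0 = ((b₀ * m : ℕ) : ℤ) ∧
          ω ∈ openConnIn {z : Site 3 | -((m : ℕ) : ℤ) < z 0} 0 y} < ε) →
    Summit.CriticalPhenomena.PercolationContinuityZ3.Theses.PercFiniteBoxLRO.RenormaliseFromLinearLRO :=
  -- STUB 9 CLOSED (lead c5, p160985): `Theorems/PercGamblersRuinBGNOffTheFloorDominance.lean`.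
  Summit.CriticalPhenomena.PercolationContinuityZ3.Theorems.stub_dominatesRenormalise

/-- **STUB 11 `splitGlueEventually`** (STRUCTURAL GLUE, lead c6 — the weakest gluing of the line's shape):
`stub_unitRatioBGN → PlaneGluingEventually → BGNOffTheFloor`, where `PlaneGluingEventually` weakens STUB 5 to
`∀ 1 ≤ a < b, ∃ C N, ∀ n ≥ N, e_n(a,b) · f((a+b) n, n) ≤ C · e_n(a,b+1)` (a constant and large `n` only).
Proof: the θ-blind case split of STUB 6 goes through with the constant `2 max(C,1)/θ(p_c)`
(`OffFloor.climbExtension_of_planeGluingEventually`), and `ClimbExtension ↔ (UnitRatioBGN → crux)`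
(`OffFloor.climbExtension_iff_unit_imp`). -/
theorem stub_splitGlueEventually :
    (∃ b₀ : ℕ, ∀ ε : ℝ, 0 < ε → ∃ᶠ m : ℕ in atTop,
      (bondPercolation (zdGraph 3) (criticalProbI 3)).real
        {ω | ∃ y : Site 3, y 0 = ((b₀ * m : ℕ) : ℤ) ∧
          ω ∈ openConnIn {z : Site 3 | -((m : ℕ) : ℤ) < z 0} 0 y} < ε) →
    (∀ a b : ℕ, 1 ≤ a → a < b → ∃ C : ℝ, ∃ N : ℕ, ∀ n : ℕ, N ≤ n →
      (bondPercolation (zdGraph 3) (criticalProbI 3)).real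
          {ω | ∃ y : Site 3, y 0 = ((b * n : ℕ) : ℤ) ∧
            ω ∈ openConnIn {z : Site 3 | -((a * n : ℕ) : ℤ) < z 0} 0 y} *
        (bondPercolation (zdGraph 3) (criticalProbI 3)).real
          {ω | ∃ y : Site 3, y 0 = ((n : ℕ) : ℤ) ∧
            ω ∈ openConnIn {z : Site 3 | -(((a + b) * n : ℕ) : ℤ) < z 0} 0 y} ≤
      C * (bondPercolation (zdGraph 3) (criticalProbI 3)).real
          {ω | ∃ y : Site 3, y 0 = (((b + 1) * n : ℕ) : ℤ) ∧
            ω ∈ openConnIn {z : Site 3 | -((a * n : ℕ) : ℤ) < z 0} 0 y}) →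
    Summit.CriticalPhenomena.PercolationContinuityZ3.Theses.PercGamblersRuin.BGNOffTheFloor :=
  -- STUB 11 CLOSED (lead c6, p164281): `Theorems/PercGamblersRuinBGNOffTheFloorBridges.lean`.
  Summit.CriticalPhenomena.PercolationContinuityZ3.Theorems.stub_splitGlueEventually

/-- **STUB 12 `planeGluingOfConj1`** (STRUCTURAL, lead c6 — certifies the open glue STUB 5 as an INSTANCE of
Kozma–Nitzan's Conjecture 1): Conjecture 1 (finite weighted graphs; min-free typing over `Fin n`, verbatim the
hypothesis of `Cruxes/NearOneGluing/KnShorteningConj1GluingProof.lean`: every common lower bound `t` of the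
`P(a ↔ b)`, `a ∈ A`, satisfies `P(o ↔ A) · t ≤ P(o ↔ b)`) implies STUB 5 verbatim. Proof
(`Theorems/PercGamblersRuinBGNOffTheFloorConjOneGluing.lean` + `Literature/…/KozmaNitzanConjecture1Transfer.lean`):
transport Conjecture 1 to finitely supported weights on `ℤ³` with a wired target plane (as `KozmaNitzanPinning`
does for Conjecture 3), apply it inside `S = {z₀ > -a n} ∩ Λ(N')` with `A = {z₀ = b n} ∩ Λ(N)`,
`T = {z₀ = (b+1) n} ∩ S` and the common lower bound `t = P(0 ⟷ {z₀ = n} in {z₀ > -(a+b) n} ∩ Λ(M))`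
(translation by `a ∈ A`, `bondPercolation_real_image`), then let `N → ∞`, `M → ∞` (continuity from below). So
a refutation of STUB 5 at any `(a,b,n)` refutes Conjecture 1 on a finite subgraph of `ℤ³` with one wired plane;
conversely Conjecture 1 as a bridge is idle for this crux (STUB 10). -/
theorem stub_planeGluingOfConj1 :
    (∀ (n : ℕ) (w : Sym2 (Fin n) → unitInterval) (A : Finset (Fin n)) (o b : Fin n) (t : ℝ),
      (∀ a ∈ A, t ≤ (prodBernoulli w).real (openConn a b)) →
      (prodBernoulli w).real (⋃ a ∈ A, openConn o a) * t ≤ (prodBernoulli w).real (openConn o b)) →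
    ∀ a b n : ℕ, 1 ≤ a → a < b → 1 ≤ n →
      (bondPercolation (zdGraph 3) (criticalProbI 3)).real
          {ω | ∃ y : Site 3, y 0 = ((b * n : ℕ) : ℤ) ∧
            ω ∈ openConnIn {z : Site 3 | -((a * n : ℕ) : ℤ) < z 0} 0 y} *
        (bondPercolation (zdGraph 3) (criticalProbI 3)).real
          {ω | ∃ y : Site 3, y 0 = ((n : ℕ) : ℤ) ∧
            ω ∈ openConnIn {z : Site 3 | -(((a + b) * n : ℕ) : ℤ) < z 0} 0 y} ≤
      (bondPercolation (zdGraph 3) (criticalProbI 3)).real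
          {ω | ∃ y : Site 3, y 0 = (((b + 1) * n : ℕ) : ℤ) ∧
            ω ∈ openConnIn {z : Site 3 | -((a * n : ℕ) : ℤ) < z 0} 0 y} :=
  -- STUB 12 CLOSED (lead c6, p165334): `Theorems/PercGamblersRuinBGNOffTheFloorConjOneGluing.lean`.
  Summit.CriticalPhenomena.PercolationContinuityZ3.Theorems.stub_planeGluingOfConj1

/-- **STUB 13 `splitGlueScaleFree`** (STRUCTURAL GLUE, lead c7 — the weakest gluing of the line's shape,
weaker than STUB 11): `stub_unitRatioBGN → JumpScaleFreeGluing → BGNOffTheFloor`, where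
`JumpScaleFreeGluing :≡ θ(p_c) > 0 → ∀ 1 ≤ a < b, ∃ c > 0, ∃ N, ∀ n ≥ N, c · e_n(a,b) ≤ e_n(a,b+1)` is
SCALE-FREE length quasi-multiplicativity of the climb probability, asked only in a jump world (it is
vacuous, hence conjunct-implied, when `θ(p_c) = 0`). Proof: θ-blind case split as in STUB 6/11 without the
Kozma–Nitzan factor (`OffFloor.climbExtension_of_jumpScaleFreeGluing`), then `ClimbExtension ↔ (UnitRatioBGN →
crux)`; and `PlaneGluingEventually → JumpScaleFreeGluing` with `c = θ(p_c)/(2 max(C,1))` since the KN factor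
is `≥ θ(p_c)/2` in a jump world (`jumpScaleFreeGluing_of_planeGluingEventually`). Why this is the honest
shape (lead c7 MC, `MC-planeGluing-c7.md`, job j026700): numerically `e_n(a,b+1)/e_n(a,b)` is scale-free
(0.747 ± 0.004 for (1,2), n = 2…12) while the KN factor of STUB 5 decays like `n^{-0.42}`, so STUB 5 over-asks
by a factor `≈ 1.25 n^{0.44}` and is numerically exposed only at n = 1 (margin 24.6 %). Landed in
`Theorems/PercGamblersRuinBGNOffTheFloorScaleFree.lean`. -/
theorem stub_splitGlueScaleFree :
    (∃ b₀ : ℕ, ∀ ε : ℝ, 0 < ε → ∃ᶠ m : ℕ in atTop,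
      (bondPercolation (zdGraph 3) (criticalProbI 3)).real
        {ω | ∃ y : Site 3, y 0 = ((b₀ * m : ℕ) : ℤ) ∧
          ω ∈ openConnIn {z : Site 3 | -((m : ℕ) : ℤ) < z 0} 0 y} < ε) →
    (0 < theta (zdGraph 3) 0 (criticalProbI 3) → ∀ a b : ℕ, 1 ≤ a → a < b →
      ∃ c : ℝ, 0 < c ∧ ∃ N : ℕ, ∀ n : ℕ, N ≤ n →
        c * (bondPercolation (zdGraph 3) (criticalProbI 3)).real
            {ω | ∃ y : Site 3, y 0 = ((b * n : ℕ) : ℤ) ∧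
              ω ∈ openConnIn {z : Site 3 | -((a * n : ℕ) : ℤ) < z 0} 0 y} ≤
          (bondPercolation (zdGraph 3) (criticalProbI 3)).real
            {ω | ∃ y : Site 3, y 0 = (((b + 1) * n : ℕ) : ℤ) ∧
              ω ∈ openConnIn {z : Site 3 | -((a * n : ℕ) : ℤ) < z 0} 0 y}) →
    Summit.CriticalPhenomena.PercolationContinuityZ3.Theses.PercGamblersRuin.BGNOffTheFloor :=
  -- STUB 13 CLOSED (lead c7, p167713): `Theorems/PercGamblersRuinBGNOffTheFloorScaleFree.lean`.
  Summit.CriticalPhenomena.PercolationContinuityZ3.Theorems.stub_splitGlueScaleFree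

/-- **STUB 6 `climbExtensionOfPlaneGluing`** (glue, lead c3 reshape — CLOSED, p153354,
`Theorems/PercGamblersRuinBGNOffTheFloorPlaneGluing.lean`, `Theorems.stub_climbExtensionOfPlaneGluing`): plane gluing implies the ladder step `ClimbExtension`
θ-BLINDLY. If `θ(p_c) = 0` every pair is off the floor outright (`OffFloor.offFloor_of_theta_eq_zero`);
if `θ(p_c) > 0` then `f((a+b) n, n) ≥ f(n, n) ≥ θ(p_c)/2` at every scale (floor monotonicity
`OffFloor.climb_real_mono` + the diagonal bound `OffFloor.theta_le_two_mul_climb_diag`), so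
`e_n(a,b) ≤ (2/θ(p_c)) e_n(a,b+1)` and `liminf = 0` transfers from `(a,b+1)` to `(a,b)`. -/
theorem stub_climbExtensionOfPlaneGluing :
    (∀ a b n : ℕ, 1 ≤ a → a < b → 1 ≤ n →
      (bondPercolation (zdGraph 3) (criticalProbI 3)).real
          {ω | ∃ y : Site 3, y 0 = ((b * n : ℕ) : ℤ) ∧
            ω ∈ openConnIn {z : Site 3 | -((a * n : ℕ) : ℤ) < z 0} 0 y} *
        (bondPercolation (zdGraph 3) (criticalProbI 3)).real
          {ω | ∃ y : Site 3, y 0 = ((n : ℕ) : ℤ) ∧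
            ω ∈ openConnIn {z : Site 3 | -(((a + b) * n : ℕ) : ℤ) < z 0} 0 y} ≤
      (bondPercolation (zdGraph 3) (criticalProbI 3)).real
          {ω | ∃ y : Site 3, y 0 = (((b + 1) * n : ℕ) : ℤ) ∧
            ω ∈ openConnIn {z : Site 3 | -((a * n : ℕ) : ℤ) < z 0} 0 y}) →
    ∀ a b : ℕ, 1 ≤ a → a < b →
      (∀ ε : ℝ, 0 < ε → ∃ᶠ n : ℕ in atTop,
        (bondPercolation (zdGraph 3) (criticalProbI 3)).real
            {ω | ∃ y : Site 3, y 0 = (((b + 1) * n : ℕ) : ℤ) ∧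
              ω ∈ openConnIn {z : Site 3 | -((a * n : ℕ) : ℤ) < z 0} 0 y} < ε) →
      ∀ ε : ℝ, 0 < ε → ∃ᶠ n : ℕ in atTop,
        (bondPercolation (zdGraph 3) (criticalProbI 3)).real
            {ω | ∃ y : Site 3, y 0 = ((b * n : ℕ) : ℤ) ∧
              ω ∈ openConnIn {z : Site 3 | -((a * n : ℕ) : ℤ) < z 0} 0 y} < ε :=
  -- STUB 6 CLOSED (lead c3, p153354): `Theorems/PercGamblersRuinBGNOffTheFloorPlaneGluing.lean`.
  Summit.CriticalPhenomena.PercolationContinuityZ3.Theorems.stub_climbExtensionOfPlaneGluing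

/-- **STUB 3 `climbExtension`** (L; since the c3 reshape DERIVED from STUBS 5 + 6, no longer registered): for `1 ≤ a < b`, `OffFloorAt a (b+1) → OffFloorAt a b`.
Sufficient one-scale form: `∃ K N, ∀ n ≥ N, e_n(a,b) ≤ K · e_n(a,b+1)` (extending a climb of `b n`
by `n` more, above the same floor, costs at most a constant factor — length-quasi-multiplicativity
of the half-space one-arm probability; BK gives only `e_n(a,b+1) ≤ e_n(a,b) · (max over level-`bn`
starts of the `n`-climb probability)`). Why it might fail: it fails exactly in a `θ(p_c) > 0` world
whose climb threshold `λ*` lies inside `(a/(b+1), a/b]`; unconditionally no 3D quasi-multiplicativity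
tool exists (planar proofs use RSW). -/
theorem stub_climbExtension : ∀ a b : ℕ, 1 ≤ a → a < b →
    (∀ ε : ℝ, 0 < ε → ∃ᶠ n : ℕ in atTop,
      (bondPercolation (zdGraph 3) (criticalProbI 3)).real
          {ω | ∃ y : Site 3, y 0 = (((b + 1) * n : ℕ) : ℤ) ∧
            ω ∈ openConnIn {z : Site 3 | -((a * n : ℕ) : ℤ) < z 0} 0 y} < ε) →
    ∀ ε : ℝ, 0 < ε → ∃ᶠ n : ℕ in atTop,
      (bondPercolation (zdGraph 3) (criticalProbI 3)).real
          {ω | ∃ y : Site 3, y 0 = ((b * n : ℕ) : ℤ) ∧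
            ω ∈ openConnIn {z : Site 3 | -((a * n : ℕ) : ℤ) < z 0} 0 y} < ε :=
  -- DERIVED since the c3 reshape: STUB 6 applied to STUB 5 (no `sorry` of its own).
  stub_climbExtensionOfPlaneGluing stub_planeGluing


/-! ### Name-keyed aliases of the stub statements
`__Registered.stub_X` is statement `X` under the registered stub's short name, so that the native skeleton
audit (`#h21_check_skeleton`: hypotheses admissible iff registered obligations / declared stubs BY NAME)
accepts `BGNOffTheFloor_of : __Registered.stub_… → … → BGNOffTheFloor`; the namespace is an implementation
detail, so the audit's stub report resolves each `stub_…` to the sorried theorem, not to its alias (device of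
`CardyFormulaZ2/Cruxes/LoopsToCrossings/Lines/br-sandwich-diagonal.lean`; the `@[stub]` attribute is gate-reserved). -/
namespace __Registered

/-- Alias of `LevelMono` keyed by the registered stub name. -/
abbrev stub_levelMono : Prop := LevelMono
/-- Alias of `UnitRatioBGN` keyed by the registered stub name. -/
abbrev stub_unitRatioBGN : Prop := UnitRatioBGN
/-- Alias of `Granularity` keyed by the registered stub name. -/
abbrev stub_granularity : Prop := Granularity
/-- Alias of `ClimbExtension` keyed by the registered stub name. -/
abbrev stub_climbExtension : Prop := ClimbExtension
/-- Alias of `RatioMono` keyed by the registered stub name. -/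
abbrev stub_ratioMono : Prop := RatioMono
/-- Alias of `PlaneGluing` keyed by the registered stub name. -/
abbrev stub_planeGluing : Prop := PlaneGluing
/-- Alias of `ClimbExtensionOfPlaneGluing` keyed by the registered stub name. -/
abbrev stub_climbExtensionOfPlaneGluing : Prop := ClimbExtensionOfPlaneGluing

end __Registered

/-! ## Proved plumbing -/

/-- In the origin-centred form the pair `(0, b)` is vacuous: the origin is not in `{z | 0 < z₀}`,
so the climb event is empty. -/
theorem climbEvent_zero_left (b n : ℕ) : climbEvent 0 b n = ∅ := by
  ext ω
  simp only [climbEvent, openConnIn, Set.mem_setOf_eq, Set.mem_empty_iff_false, iff_false]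
  rintro ⟨y, -, hx, -, -⟩
  simp at hx

theorem climbProb_zero_left (b n : ℕ) : climbProb 0 b n = 0 := by
  rw [climbProb, climbEvent_zero_left, measureReal_empty]

theorem offFloorAt_zero_left (b : ℕ) : OffFloorAt 0 b := fun ε hε =>
  Frequently.of_forall fun n => by rw [climbProb_zero_left]; exact hε

theorem climbProb_nonneg (a b n : ℕ) : 0 ≤ climbProb a b n := measureReal_nonneg

theorem climbProb_le_one (a b n : ℕ) : climbProb a b n ≤ 1 := measureReal_le_one

/-- STUB 1 transports `OffFloorAt` to higher ceilings at the same floor. -/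
theorem OffFloorAt.mono_right (hmono : LevelMono) {a b b' : ℕ} (hbb' : b ≤ b') (h : OffFloorAt a b) :
    OffFloorAt a b' := fun ε hε =>
  (h ε hε).mono fun n hn => lt_of_le_of_lt (hmono a b b' n hbb') hn

/-- STUBS 2 and 3 are CONSEQUENCES of the crux (honest pieces; with STUB 1 jointly equivalent to it). -/
theorem smallRatioBGN_of (h : BGNOffTheFloor) : SmallRatioBGN :=
  ⟨2, fun a ha => h a (a * 2) (by omega)⟩

/-- The reshaped STUB 2 is the instance `(a, b) = (1, 2)` of the crux. -/
theorem unitRatioBGN_of (h : BGNOffTheFloor) : UnitRatioBGN :=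
  ⟨2, fun ε hε => by
    simpa only [unitClimbProb, climbProb, climbEvent, one_mul] using h 1 2 (by omega) ε hε⟩

theorem climbExtension_of (h : BGNOffTheFloor) : ClimbExtension :=
  fun a b _ hab _ => h a b hab

/-! ## Alternative glue: the ladder step from linear-scale long-range order (wave-1 worker, p153598)
The stub-worker of the c3 wave on the former STUB 3 returned `stub-blocked:
Summit.CriticalPhenomena.PercolationContinuityZ3.Theses.PercFiniteBoxLRO.LinearScaleLROOfTheta` with a
kernel-checked reduction, landed by the lead as `Theorems/PercGamblersRuinBGNOffTheFloorLinearLRO.lean`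
(registered glue stub `stub_climbExtensionOfAxialLRO`): FKG chaining of AXIAL linear-scale box connections
above the receding floor gives `e_n(a,b) ≥ ρ^(K' b)` (θ-blind, any `p`), so axial linear-scale LRO at `p_c`
in a jump world (the axial `p = p_c` instances of crux 0855 `X_D` of route `PercFiniteBoxLRO`) makes EVERY
pair climbable (`λ* = 0`), refuting the hypothesis of the ladder step; with the `θ(p_c) = 0` case trivial,
`ClimbExtension` follows θ-blindly — and under the same hypothesis `UnitRatioBGN → θ(p_c) = 0`
(`OffFloor.theta_eq_zero_of_unitRatioBGN_of_axialLRO`), i.e. modulo `X_D` the whole crux and already its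
existential shadow are conjunct-EQUIVALENT (answering `LEAD-c2-STATUS.md` §6). -/

/-- Axial linear-scale long-range order at `p_c` in a jump world: `θ(p_c) > 0 → ∃ ρ > 0, K, ∀ m ≥ 1,
P_{p_c}(-m e₀ ↔ m e₀ in Λ(K m)) ≥ ρ` (the axial `p = p_c` instances of `PercFiniteBoxLRO.LinearScaleLROOfTheta`). -/
def AxialLinearLROAtPc : Prop :=
  0 < theta (zdGraph 3) 0 (criticalProbI 3) →
    ∃ ρ : ℝ, 0 < ρ ∧ ∃ K : ℕ, ∀ m : ℕ, 1 ≤ m →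
      ρ ≤ (bondPercolation (zdGraph 3) (criticalProbI 3)).real
        (openConnIn (↑(box 3 (K * m)) : Set (Site 3)) (Pi.single 0 (-(m : ℤ))) (Pi.single 0 (m : ℤ)))

/-- **Alternative to STUBS 5 + 6**: axial linear-scale LRO at `p_c` implies the ladder step
(`Theorems.stub_climbExtensionOfAxialLRO`, p153598). So `BGNOffTheFloor_of hunit` can equally be fed by
`climbExtension_of_axialLRO hAx` in place of `stub_climbExtensionOfPlaneGluing hplane`. -/
theorem climbExtension_of_axialLRO (hAx : AxialLinearLROAtPc) : ClimbExtension :=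
  Summit.CriticalPhenomena.PercolationContinuityZ3.Theorems.stub_climbExtensionOfAxialLRO hAx

/-- The crux `X_D` of route `PercFiniteBoxLRO` contains the axial instances at `p_c`. -/
theorem axialLinearLROAtPc_of_linearScaleLROOfTheta
    (hX : Summit.CriticalPhenomena.PercolationContinuityZ3.Theses.PercFiniteBoxLRO.LinearScaleLROOfTheta) :
    AxialLinearLROAtPc := fun hθ => by
  obtain ⟨ρ, hρ, K, hK⟩ := hX (criticalProbI 3) hθ
  exact ⟨ρ, hρ, K, Summit.CriticalPhenomena.PercolationContinuityZ3.Theorems.OffFloor.axialLRO_of_boxLRO hK⟩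

/-- Under axial linear-scale LRO at `p_c` the open STUB 2 is conjunct-equivalent:
`UnitRatioBGN ↔ θ(p_c) = 0`. -/
theorem unitRatioBGN_iff_theta_eq_zero_of_axialLRO (hAx : AxialLinearLROAtPc) :
    UnitRatioBGN ↔ theta (zdGraph 3) 0 (criticalProbI 3) = 0 :=
  ⟨fun h => Summit.CriticalPhenomena.PercolationContinuityZ3.Theorems.OffFloor.theta_eq_zero_of_unitRatioBGN_of_axialLRO
      hAx h,
    fun hθ => unitRatioBGN_of
      (Summit.CriticalPhenomena.PercolationContinuityZ3.Theorems.OffFloor.bgnOffTheFloor_of_theta_eq_zero hθ)⟩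

/-! ## The composition, by name -/

/-- Downward induction on the height of the ceiling: from the ceilings `b ≥ B` down to `b = a + 1`
by STUB 3. -/
theorem offFloorAt_downward {a B : ℕ} (ha : 1 ≤ a) (hbase : ∀ b : ℕ, B ≤ b → OffFloorAt a b)
    (hext : ClimbExtension) : ∀ j b : ℕ, a < b → B ≤ b + j → OffFloorAt a b := by
  intro j
  induction j with
  | zero => exact fun b _ hj => hbase b (by simpa using hj)
  | succ j ih => exact fun b hb hj => hext a b ha hb (ih (b + 1) (Nat.lt_succ_of_lt hb) (by omega))

/-- **From `UnitRatioBGN`, ONE pair `(a, b)` with `1 ≤ a < b` off the floor** (lead c3): for the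
witness `b₀` of `UnitRatioBGN`, `b₀ = 0` is impossible (the event `E(m, 0)` is sure for `m ≥ 1`),
`b₀ = 1` is the diagonal, along which `liminf = 0` forces `θ(p_c) = 0`
(`OffFloor.theta_le_two_mul_climb_diag`) and hence every pair (`OffFloor.offFloor_of_theta_eq_zero`),
and `b₀ ≥ 2` is the pair `(1, b₀)`. -/
theorem exists_pair_of_unit (hunit : UnitRatioBGN) : ∃ a b : ℕ, 1 ≤ a ∧ a < b ∧ OffFloorAt a b := by
  obtain ⟨b₀, h⟩ := hunit
  rcases Nat.lt_or_ge b₀ 2 with hb | hb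
  · interval_cases b₀
    · -- `b₀ = 0`: the event is sure for `m ≥ 1`
      exfalso
      obtain ⟨m, hlt, hm⟩ := ((h 1 one_pos).and_eventually (eventually_ge_atTop 1)).exists
      have huniv : {ω : BondConfig (Site 3) | ∃ y : Site 3, y 0 = ((0 * m : ℕ) : ℤ) ∧
          ω ∈ openConnIn {z : Site 3 | -((m : ℕ) : ℤ) < z 0} 0 y} = Set.univ := by
        refine Set.eq_univ_of_forall fun ω => ⟨0, by simp, ?_⟩
        have h0 : (0 : Site 3) ∈ {z : Site 3 | -((m : ℕ) : ℤ) < z 0} := by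
          simp only [Set.mem_setOf_eq, Pi.zero_apply]; omega
        exact ⟨h0, h0, SimpleGraph.Reachable.refl _⟩
      simp only [unitClimbProb] at hlt
      rw [huniv, probReal_univ] at hlt
      exact lt_irrefl _ hlt
    · -- `b₀ = 1`: the diagonal forces `θ(p_c) = 0`
      have hθ : theta (zdGraph 3) 0 (criticalProbI 3) = 0 := by
        refine le_antisymm (le_of_forall_pos_lt_add fun ε hε => ?_) measureReal_nonneg
        obtain ⟨n, hlt, hn⟩ :=
          ((h (ε / 2) (by positivity)).and_eventually (eventually_ge_atTop 1)).exists
        have hdiag := Theorems.OffFloor.theta_le_two_mul_climb_diag n hn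
        simp only [unitClimbProb, one_mul] at hlt
        change (bondPercolation (zdGraph 3) (criticalProbI 3)).real _ < ε / 2 at hlt
        linarith
      exact ⟨1, 2, le_rfl, one_lt_two, fun ε hε => by
        simpa only [climbProb, climbEvent] using
          Theorems.OffFloor.offFloor_of_theta_eq_zero hθ 1 2 (by norm_num) ε hε⟩
  · exact ⟨1, b₀, le_rfl, hb, fun ε hε => by
      simpa only [unitClimbProb, climbProb, climbEvent, one_mul] using h ε hε⟩

/-- **`BGNOffTheFloor_of`** (composition, lead c3 reshape): the registered stubs imply the crux
`Summit.CriticalPhenomena.PercolationContinuityZ3.Theses.PercGamblersRuin.BGNOffTheFloor`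
(kernel-checked; no `sorry` outside the stubs). From `UnitRatioBGN` take one pair `(a₁, b₁)` off the
floor (`exists_pair_of_unit`); for `1 ≤ a < b` every ceiling `b' ≥ a b₁ + 1` above the floor `a` has
ratio `a/b' < a₁/b₁`, hence is off the floor by STUB 4 (`ratioMono`); lower the ceiling one unit at a
time down to `b` with STUB 3 (`climbExtension`). The case `a = 0` is vacuous. (The c2 composition via
STUB 1 `levelMono` + STUB 2b `granularity`, both landed, remains valid; this one needs neither.) -/
theorem BGNOffTheFloor_of (hunit : __Registered.stub_unitRatioBGN) (hplane : __Registered.stub_planeGluing) :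
    Summit.CriticalPhenomena.PercolationContinuityZ3.Theses.PercGamblersRuin.BGNOffTheFloor := by
  -- STUBS 4 and 6 are closed (p152651, p153354): `stub_ratioMono`, `stub_climbExtensionOfPlaneGluing`
  -- are theorems, used here by name.
  have hratio : RatioMono := stub_ratioMono
  have hglue : ClimbExtensionOfPlaneGluing := stub_climbExtensionOfPlaneGluing
  have hext : ClimbExtension := hglue hplane
  obtain ⟨a₁, b₁, ha₁, -, hoff⟩ := exists_pair_of_unit hunit
  intro a b hab
  rcases Nat.eq_zero_or_pos a with rfl | ha
  · exact offFloorAt_zero_left b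
  · have hbase : ∀ b' : ℕ, a * b₁ + 1 ≤ b' → OffFloorAt a b' :=
      fun b' hb' => hratio a₁ b₁ a b' (by nlinarith) hoff
    exact offFloorAt_downward ha hbase hext (a * b₁ + 1) b hab (by omega)

/-- Wiring check: the registered stubs feed `BGNOffTheFloor_of` as stated. -/
example : Summit.CriticalPhenomena.PercolationContinuityZ3.Theses.PercGamblersRuin.BGNOffTheFloor :=
  BGNOffTheFloor_of stub_unitRatioBGN stub_planeGluing

/-- **Exactness of the split.** Given STUB 4 (proved), the crux is EQUIVALENT to the conjunction of
its two open stubs: `BGNOffTheFloor ↔ UnitRatioBGN ∧ ClimbExtension` — both are consequences of the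
crux (`unitRatioBGN_of`, `climbExtension_of`) and jointly imply it (`BGNOffTheFloor_of`). Sharper
(Threshold file, `OffFloor.climbExtension_iff_unit_imp`): `ClimbExtension ↔ (UnitRatioBGN → crux)`,
so the split has the shape `crux ↔ U ∧ (U → crux)` with `U = UnitRatioBGN` the existential shadow
`∃ (a,b), 1 ≤ a < b, OffFloorAt a b` of the crux (`OffFloor.unitRatioBGN_iff_exists_pair`). -/
theorem bgnOffTheFloor_iff_open_stubs (hratio : RatioMono) :
    BGNOffTheFloor ↔ UnitRatioBGN ∧ ClimbExtension :=
  ⟨fun h => ⟨unitRatioBGN_of h, climbExtension_of h⟩,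
    fun h => by
      obtain ⟨a₁, b₁, ha₁, -, hoff⟩ := exists_pair_of_unit h.1
      intro a b hab
      rcases Nat.eq_zero_or_pos a with rfl | ha
      · exact offFloorAt_zero_left b
      · have hbase : ∀ b' : ℕ, a * b₁ + 1 ≤ b' → OffFloorAt a b' :=
          fun b' hb' => hratio a₁ b₁ a b' (by nlinarith) hoff
        exact offFloorAt_downward ha hbase h.2 (a * b₁ + 1) b hab (by omega)⟩

/-- Under plane gluing (STUB 5) and the proved glue (STUBS 4, 6) the crux is EQUIVALENT to its
existential shadow `UnitRatioBGN` alone. -/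
theorem bgnOffTheFloor_iff_unit (hplane : PlaneGluing) : BGNOffTheFloor ↔ UnitRatioBGN :=
  ⟨unitRatioBGN_of, fun h => BGNOffTheFloor_of h hplane⟩

/-- **STUB 10 `nearOneGluingDominates`** (STRUCTURAL, lead c6 — not an antecedent of `BGNOffTheFloor_of`;
records a cross-route DOMINANCE edge that is a theorem in the tree): the crux `NearOneGluing`
(stmt-CriticalPhenomena-4574 = Kozma–Nitzan Conjecture 3 over finite weighted graphs) of route
`PercNearOneGluing` implies this crux — its bridge `KNSlabBridge` (KN 2024 Theorem 6 at `d = 3`,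
`Theorems.KNSlabBridge_proof`) and its assembly (`Theorems.percNearOneGluing_assembly_proof`, DST 2016) are
PROVED, so `NearOneGluing ⟹ θ(p_c) = 0 ⟹ BGNOffTheFloor` (`OffFloor.bgnOffTheFloor_of_percolationContinuityZ3`).
The same file records `AdditiveGluing (4576) ⟹ crux`, `NoHeavyLowerTail (4575) ⟹ crux` and
`KN Conjecture 1 ⟹ AdditiveGluing ⟹ crux`: the open glue STUB 5 is an instance of Conjecture 1, and
Conjecture 1 as a bridge is idle here (it closes the sub-problem in the tree). -/
theorem stub_nearOneGluingDominates :
    Summit.CriticalPhenomena.PercolationContinuityZ3.Theses.PercNearOneGluing.NearOneGluing →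
    Summit.CriticalPhenomena.PercolationContinuityZ3.Theses.PercGamblersRuin.BGNOffTheFloor :=
  -- STUB 10 CLOSED (lead c6, p164281): `Theorems/PercGamblersRuinBGNOffTheFloorBridges.lean`.
  Summit.CriticalPhenomena.PercolationContinuityZ3.Theorems.stub_nearOneGluingDominates

/-- Readbacks: the registered (self-contained) stub signatures ARE the named statements. -/
theorem unitRatioBGN_iff : UnitRatioBGN ↔ ∃ b₀ : ℕ, ∀ ε : ℝ, 0 < ε → ∃ᶠ m : ℕ in atTop,
    (bondPercolation (zdGraph 3) (criticalProbI 3)).real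
        {ω | ∃ y : Site 3, y 0 = ((b₀ * m : ℕ) : ℤ) ∧
          ω ∈ openConnIn {z : Site 3 | -((m : ℕ) : ℤ) < z 0} 0 y} < ε := Iff.rfl

theorem granularity_iff : Granularity ↔
    ((∃ b₀ : ℕ, ∀ ε : ℝ, 0 < ε → ∃ᶠ m : ℕ in atTop,
      (bondPercolation (zdGraph 3) (criticalProbI 3)).real
        {ω | ∃ y : Site 3, y 0 = ((b₀ * m : ℕ) : ℤ) ∧
          ω ∈ openConnIn {z : Site 3 | -((m : ℕ) : ℤ) < z 0} 0 y} < ε) →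
    ∃ b₀ : ℕ, ∀ a : ℕ, 1 ≤ a → ∀ ε : ℝ, 0 < ε → ∃ᶠ n : ℕ in atTop,
      (bondPercolation (zdGraph 3) (criticalProbI 3)).real
        {ω | ∃ y : Site 3, y 0 = ((a * b₀ * n : ℕ) : ℤ) ∧
          ω ∈ openConnIn {z : Site 3 | -((a * n : ℕ) : ℤ) < z 0} 0 y} < ε) := Iff.rfl

theorem levelMono_iff : LevelMono ↔ ∀ a b b' n : ℕ, b ≤ b' →
    (bondPercolation (zdGraph 3) (criticalProbI 3)).real
        {ω | ∃ y : Site 3, y 0 = ((b' * n : ℕ) : ℤ) ∧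
          ω ∈ openConnIn {z : Site 3 | -((a * n : ℕ) : ℤ) < z 0} 0 y} ≤
      (bondPercolation (zdGraph 3) (criticalProbI 3)).real
        {ω | ∃ y : Site 3, y 0 = ((b * n : ℕ) : ℤ) ∧
          ω ∈ openConnIn {z : Site 3 | -((a * n : ℕ) : ℤ) < z 0} 0 y} := Iff.rfl

theorem smallRatioBGN_iff : SmallRatioBGN ↔ ∃ b₀ : ℕ, ∀ a : ℕ, 1 ≤ a → ∀ ε : ℝ, 0 < ε →
    ∃ᶠ n : ℕ in atTop, (bondPercolation (zdGraph 3) (criticalProbI 3)).real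
        {ω | ∃ y : Site 3, y 0 = ((a * b₀ * n : ℕ) : ℤ) ∧
          ω ∈ openConnIn {z : Site 3 | -((a * n : ℕ) : ℤ) < z 0} 0 y} < ε := Iff.rfl

theorem climbExtension_iff : ClimbExtension ↔ ∀ a b : ℕ, 1 ≤ a → a < b →
    (∀ ε : ℝ, 0 < ε → ∃ᶠ n : ℕ in atTop,
      (bondPercolation (zdGraph 3) (criticalProbI 3)).real
          {ω | ∃ y : Site 3, y 0 = (((b + 1) * n : ℕ) : ℤ) ∧
            ω ∈ openConnIn {z : Site 3 | -((a * n : ℕ) : ℤ) < z 0} 0 y} < ε) →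
    ∀ ε : ℝ, 0 < ε → ∃ᶠ n : ℕ in atTop,
      (bondPercolation (zdGraph 3) (criticalProbI 3)).real
          {ω | ∃ y : Site 3, y 0 = ((b * n : ℕ) : ℤ) ∧
            ω ∈ openConnIn {z : Site 3 | -((a * n : ℕ) : ℤ) < z 0} 0 y} < ε := Iff.rfl

theorem ratioMono_iff : RatioMono ↔ ∀ a b a' b' : ℕ, a' * b < a * b' →
    (∀ ε : ℝ, 0 < ε → ∃ᶠ n : ℕ in atTop,
      (bondPercolation (zdGraph 3) (criticalProbI 3)).real
        {ω | ∃ y : Site 3, y 0 = ((b * n : ℕ) : ℤ) ∧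
          ω ∈ openConnIn {z : Site 3 | -((a * n : ℕ) : ℤ) < z 0} 0 y} < ε) →
    ∀ ε : ℝ, 0 < ε → ∃ᶠ n : ℕ in atTop,
      (bondPercolation (zdGraph 3) (criticalProbI 3)).real
        {ω | ∃ y : Site 3, y 0 = ((b' * n : ℕ) : ℤ) ∧
          ω ∈ openConnIn {z : Site 3 | -((a' * n : ℕ) : ℤ) < z 0} 0 y} < ε := Iff.rfl

theorem planeGluing_iff : PlaneGluing ↔ ∀ a b n : ℕ, 1 ≤ a → a < b → 1 ≤ n →
    (bondPercolation (zdGraph 3) (criticalProbI 3)).real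
        {ω | ∃ y : Site 3, y 0 = ((b * n : ℕ) : ℤ) ∧
          ω ∈ openConnIn {z : Site 3 | -((a * n : ℕ) : ℤ) < z 0} 0 y} *
      (bondPercolation (zdGraph 3) (criticalProbI 3)).real
        {ω | ∃ y : Site 3, y 0 = ((n : ℕ) : ℤ) ∧
          ω ∈ openConnIn {z : Site 3 | -(((a + b) * n : ℕ) : ℤ) < z 0} 0 y} ≤
    (bondPercolation (zdGraph 3) (criticalProbI 3)).real
        {ω | ∃ y : Site 3, y 0 = (((b + 1) * n : ℕ) : ℤ) ∧
          ω ∈ openConnIn {z : Site 3 | -((a * n : ℕ) : ℤ) < z 0} 0 y} := Iff.rfl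

theorem climbExtensionOfPlaneGluing_iff : ClimbExtensionOfPlaneGluing ↔
    ((∀ a b n : ℕ, 1 ≤ a → a < b → 1 ≤ n →
      (bondPercolation (zdGraph 3) (criticalProbI 3)).real
          {ω | ∃ y : Site 3, y 0 = ((b * n : ℕ) : ℤ) ∧
            ω ∈ openConnIn {z : Site 3 | -((a * n : ℕ) : ℤ) < z 0} 0 y} *
        (bondPercolation (zdGraph 3) (criticalProbI 3)).real
          {ω | ∃ y : Site 3, y 0 = ((n : ℕ) : ℤ) ∧
            ω ∈ openConnIn {z : Site 3 | -(((a + b) * n : ℕ) : ℤ) < z 0} 0 y} ≤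
      (bondPercolation (zdGraph 3) (criticalProbI 3)).real
          {ω | ∃ y : Site 3, y 0 = (((b + 1) * n : ℕ) : ℤ) ∧
            ω ∈ openConnIn {z : Site 3 | -((a * n : ℕ) : ℤ) < z 0} 0 y}) →
    ∀ a b : ℕ, 1 ≤ a → a < b →
      (∀ ε : ℝ, 0 < ε → ∃ᶠ n : ℕ in atTop,
        (bondPercolation (zdGraph 3) (criticalProbI 3)).real
            {ω | ∃ y : Site 3, y 0 = (((b + 1) * n : ℕ) : ℤ) ∧
              ω ∈ openConnIn {z : Site 3 | -((a * n : ℕ) : ℤ) < z 0} 0 y} < ε) →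
      ∀ ε : ℝ, 0 < ε → ∃ᶠ n : ℕ in atTop,
        (bondPercolation (zdGraph 3) (criticalProbI 3)).real
            {ω | ∃ y : Site 3, y 0 = ((b * n : ℕ) : ℤ) ∧
              ω ∈ openConnIn {z : Site 3 | -((a * n : ℕ) : ℤ) < z 0} 0 y} < ε) := Iff.rfl

end Summit.CriticalPhenomena.PercolationContinuityZ3.Cruxes.BGNOffTheFloor.Birth

end
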